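import Summits.CriticalPhenomena.SAWScalingLimit.Theorems.SAWDevelopingMapObservableToSLETypeLadderCarvedReductionSqueezeLimitCover
import HarnessLib

/-!
# The union of the closed limit hexagons of one removed level is CONNECTED
# (piece (T-A′₂ union) of stub T-A′₂ `stub_carvedReduction_squeezeGeometry_domainsCore`)

Crux `SAWDevelopingMap.ObservableToSLE` (stmt-CriticalPhenomena-10472), line `six-class-type-ladder`,
stub T-A′₂ `stub_carvedReduction_squeezeGeometry_domainsCore`.  Landing target:
`Summits/CriticalPhenomena/SAWScalingLimit/Theorems/SAWDevelopingMapObservableToSLETypeLadderCarvedReductionSqueezeLimitUnion.lean`.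

The complement of the limit bulk `Ω` must be connected (hypothesis of the twin's inner-approximant
contract p144792).  Its core is this file: along the package subsequence the removed level `U j`
is EXACTLY the union of `N` tracked cells `hexBall (g j i).1 (g j i).2` with pinned centres
`→ C i` and pinned radii `→ ϱ i` (`TypeLadder.squeeze_limitPackage`), and `U j` is preconnected in
the honeycomb lattice (`TameNestedFamily`); then
* `eventually_cells_subset_thicken` — PER-CELL containment: eventually every vertex of the cell
  `i` is pinned into the `ε`-thickened limit hexagon `Hex(C i, ϱ i + ε)`, uniformly in `i`;
* `isConnected_iUnion_limitHex` — `⋃ i, Hex(C i, ϱ i)` is connected: the cell-adjacency graphs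
  of the levels are connected, a pair of cells adjacent at infinitely many levels has
  intersecting limit hexagons (two disjoint compact hexagons are separated by skew thickenings,
  `exists_pos_disjoint_skewHex_thicken`), and from some level on every adjacency is such a pair
  (no further subsequence);
* `mem_iUnion_limitHex_of_tendsto` — the limit of any convergent sequence of pinned removed
  vertices (e.g. the pinned roots `→ D.pt 0 - τ`) lies in the union;
* `isConnected_compl_connectedComponentIn` — plane topology: a component `Ω` of an open set `O`
  with `Oᶜ` connected has connected complement (every other component accumulates at `Oᶜ`).
Registered carrier: `stub_carvedReduction_limitUnion`.
-/

noncomputable section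

open scoped Topology
open Filter Set Metric Relation
open Literature.Probability.LatticeModels (HexVertex hexGraph hexCenter triEmbed Site)
open Literature.Probability.RandomPlanarGeometry

namespace Summit.CriticalPhenomena.SAWScalingLimit.Theorems.ObservableToSLE.TypeLadder

open Summit.CriticalPhenomena.SAWScalingLimit.Theorems.ObservableToSLER.BridgeGate
open Summit.CriticalPhenomena.SAWScalingLimit.Theorems.ObservableToSLER.TwoPiece (dist_smul_hexCenter_le_of_adj)

/-! ### Closed limit hexagons are convex, hence connected -/

/-- The closed regular skew hexagon `Hex(C, ϱ)` is convex. -/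
theorem convex_skewHexAbs (C : ℂ) (ϱ : ℝ) : Convex ℝ {z : ℂ | ∀ ℓ : Fin 3, |skewCoord ℓ (z - C)| ≤ ϱ} := by
  intro z hz w hw a b ha hb hab ℓ
  have e : a • z + b • w - C = ((a : ℝ) : ℂ) * (z - C) + ((b : ℝ) : ℂ) * (w - C) := by
    rw [Complex.real_smul, Complex.real_smul]
    have : (C : ℂ) = ((a : ℝ) : ℂ) * C + ((b : ℝ) : ℂ) * C := by
      rw [← add_mul, ← Complex.ofReal_add, hab, Complex.ofReal_one, one_mul]
    conv_lhs => rw [this]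
    ring
  rw [e, skewCoord_add, skewCoord_real_mul, skewCoord_real_mul]
  refine (abs_add_le _ _).trans ?_
  rw [abs_mul, abs_mul, abs_of_nonneg ha, abs_of_nonneg hb]
  calc a * |skewCoord ℓ (z - C)| + b * |skewCoord ℓ (w - C)| ≤ a * ϱ + b * ϱ :=
        add_le_add (mul_le_mul_of_nonneg_left (hz ℓ) ha) (mul_le_mul_of_nonneg_left (hw ℓ) hb)
    _ = ϱ := by rw [← add_mul, hab, one_mul]

/-- The closed regular skew hexagon `Hex(C, ϱ)`, `ϱ ≥ 0`, is connected (it contains `C`). -/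
theorem isConnected_skewHexAbs (C : ℂ) {ϱ : ℝ} (hϱ : 0 ≤ ϱ) :
    IsConnected {z : ℂ | ∀ ℓ : Fin 3, |skewCoord ℓ (z - C)| ≤ ϱ} :=
  (convex_skewHexAbs C ϱ).isConnected ⟨C, fun ℓ => by rw [sub_self]; fin_cases ℓ <;> simp [skewCoord, hϱ]⟩

/-! ### Per-cell containment -/

section Cells

variable {N : ℕ} {s : ℕ → ℝ} {x : ℕ → Site 2} {g : ℕ → Fin N → HexVertex × ℕ} {C : Fin N → ℂ} {ϱ : Fin N → ℝ}

/-- **PER-CELL CONTAINMENT**: if the pinned centres of the cells converge to `C i` and the pinned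
radii `s_j (r + 1/2)` to `ϱ i`, then for every `ε > 0`, eventually, every vertex of the cell `i`
is pinned into `Hex(C i, ϱ i + ε)`, for all `i` at once. -/
theorem eventually_cells_subset_thicken (hs : ∀ j, 0 < s j) (hs0 : Tendsto s atTop (𝓝 0))
    (hC : ∀ i, Tendsto (fun j => (s j : ℂ) * hexCenter (g j i).1 - (s j : ℂ) * triEmbed (x j)) atTop (𝓝 (C i)))
    (hϱ : ∀ i, Tendsto (fun j => s j * ((g j i).2 + 1 / 2)) atTop (𝓝 (ϱ i))) {ε : ℝ} (hε : 0 < ε) :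
    ∀ᶠ j in atTop, ∀ (i : Fin N), ∀ v ∈ hexBall (g j i).1 (g j i).2, ∀ ℓ : Fin 3,
      |skewCoord ℓ ((s j : ℂ) * hexCenter v - (s j : ℂ) * triEmbed (x j) - C i)| ≤ ϱ i + ε := by
  have h1 : ∀ᶠ j in atTop, ∀ i, dist ((s j : ℂ) * hexCenter (g j i).1 - (s j : ℂ) * triEmbed (x j)) (C i) < ε / 6 := by
    rw [eventually_all]; exact fun i => Metric.tendsto_nhds.1 (hC i) _ (by positivity)
  have h2 : ∀ᶠ j in atTop, ∀ i, s j * ((g j i).2 + 1 / 2) < ϱ i + ε / 3 := by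
    rw [eventually_all]; exact fun i => (hϱ i).eventually (gt_mem_nhds (by linarith))
  have h3 : ∀ᶠ j in atTop, s j < ε := hs0.eventually (gt_mem_nhds hε)
  filter_upwards [h1, h2, h3] with j hj1 hj2 hj3 i v hv ℓ
  set τ : ℂ := (s j : ℂ) * triEmbed (x j) with hτ
  have hcont : (s j : ℂ) * hexCenter v - τ + τ ∈ contHex (s j) (g j i).1 (g j i).2 := by
    rw [sub_add_cancel]; exact (mem_hexBall_iff_hexCenter_mem_contHex (hs j) _ _ _).1 hv
  have h4 := abs_le_of_pinned_mem_contHex (hs j) (g j i).1 (g j i).2 τ _ hcont ℓ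
  have h5 := abs_skewCoord_sub_le_of_dist ℓ ((s j : ℂ) * hexCenter v - τ)
    ((s j : ℂ) * hexCenter (g j i).1 - τ) (C i)
  have h6 := hj1 i
  have h7 := hj2 i
  linarith [(hs j).le]

/-- Per-cell containment implies the package's containment clause (`∃ i`) for the whole level. -/
theorem eventually_level_subset_thicken (hs : ∀ j, 0 < s j) (hs0 : Tendsto s atTop (𝓝 0))
    {U : ℕ → Set HexVertex} (hU : ∀ j (v : HexVertex), v ∈ U j ↔ ∃ i, v ∈ hexBall (g j i).1 (g j i).2)
    (hC : ∀ i, Tendsto (fun j => (s j : ℂ) * hexCenter (g j i).1 - (s j : ℂ) * triEmbed (x j)) atTop (𝓝 (C i)))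
    (hϱ : ∀ i, Tendsto (fun j => s j * ((g j i).2 + 1 / 2)) atTop (𝓝 (ϱ i))) :
    ∀ ε > (0 : ℝ), ∀ᶠ j in atTop, ∀ v ∈ U j, ∃ i : Fin N, ∀ ℓ : Fin 3,
      |skewCoord ℓ ((s j : ℂ) * hexCenter v - (s j : ℂ) * triEmbed (x j) - C i)| ≤ ϱ i + ε := by
  intro ε hε
  filter_upwards [eventually_cells_subset_thicken hs hs0 hC hϱ hε] with j hj v hv
  obtain ⟨i, hi⟩ := (hU j v).1 hv
  exact ⟨i, hj i v hi⟩

/-- **The limit of a convergent sequence of pinned removed vertices lies in the union of the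
closed limit hexagons** (e.g. the pinned roots, converging to `D.pt 0 - τ`). -/
theorem mem_iUnion_limitHex_of_tendsto (hs : ∀ j, 0 < s j) (hs0 : Tendsto s atTop (𝓝 0))
    {U : ℕ → Set HexVertex} (hU : ∀ j (v : HexVertex), v ∈ U j ↔ ∃ i, v ∈ hexBall (g j i).1 (g j i).2)
    (hC : ∀ i, Tendsto (fun j => (s j : ℂ) * hexCenter (g j i).1 - (s j : ℂ) * triEmbed (x j)) atTop (𝓝 (C i)))
    (hϱ : ∀ i, Tendsto (fun j => s j * ((g j i).2 + 1 / 2)) atTop (𝓝 (ϱ i)))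
    {w : ℕ → HexVertex} (hw : ∀ᶠ j in atTop, w j ∈ U j) {z : ℂ}
    (hz : Tendsto (fun j => (s j : ℂ) * hexCenter (w j) - (s j : ℂ) * triEmbed (x j)) atTop (𝓝 z)) :
    z ∈ ⋃ i, {z : ℂ | ∀ ℓ : Fin 3, |skewCoord ℓ (z - C i)| ≤ ϱ i} := by
  obtain ⟨i, hi⟩ := mem_limitHex_of_frequently_near (eventually_level_subset_thicken hs hs0 hU hC hϱ)
    (z := z) fun ε hε => ((Metric.tendsto_nhds.1 hz ε hε).and hw).frequently.mono
      fun j ⟨hj1, hj2⟩ => ⟨w j, hj2, hj1⟩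
  exact mem_iUnion.2 ⟨i, hi⟩

/-! ### The union of the limit hexagons is connected -/

/-- **The cell-adjacency graph of a preconnected level is connected** (cells `a`, `b` of level `j`
are ADJACENT if some vertices of theirs are rescaled within `s j` of each other: the same vertex,
or two honeycomb neighbours). -/
theorem reflTransGen_cellAdj (hs : ∀ j, 0 < s j) {U : ℕ → Set HexVertex}
    (hU : ∀ j (v : HexVertex), v ∈ U j ↔ ∃ i, v ∈ hexBall (g j i).1 (g j i).2)
    (hpre : ∀ j, (hexGraph.induce (U j)).Preconnected) (j : ℕ) (i i' : Fin N) :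
    ReflTransGen (fun a b : Fin N => ∃ v ∈ hexBall (g j a).1 (g j a).2, ∃ w ∈ hexBall (g j b).1 (g j b).2,
      dist ((s j : ℂ) * hexCenter v) ((s j : ℂ) * hexCenter w) ≤ s j) i i' := by
  classical
  set cellAdj : Set (Fin N × Fin N) := {p | ∃ v ∈ hexBall (g j p.1).1 (g j p.1).2, ∃ w ∈ hexBall (g j p.2).1 (g j p.2).2,
    dist ((s j : ℂ) * hexCenter v) ((s j : ℂ) * hexCenter w) ≤ s j} with hcellAdj
  change ReflTransGen (fun a b => (a, b) ∈ cellAdj) i i'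
  -- a cell index for every vertex of the level
  have hk : ∀ u : U j, ∃ k, (u : HexVertex) ∈ hexBall (g j k).1 (g j k).2 := fun u => (hU j u).1 u.2
  choose k hk using hk
  have hstep : ∀ u u' : U j, (hexGraph.induce (U j)).Adj u u' → (k u, k u') ∈ cellAdj := by
    intro u u' h
    rw [SimpleGraph.comap_adj, Function.Embedding.coe_subtype] at h
    exact ⟨u, hk u, u', hk u', dist_smul_hexCenter_le_of_adj (hs j).le h⟩
  have hsame : ∀ (u : HexVertex) (a b : Fin N), u ∈ hexBall (g j a).1 (g j a).2 → u ∈ hexBall (g j b).1 (g j b).2 →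
      (a, b) ∈ cellAdj := fun u a b ha hb => ⟨u, ha, u, hb, by rw [dist_self]; exact (hs j).le⟩
  -- the centres of the two cells, joined by a walk of the level
  set v₀ : HexVertex := (g j i).1
  set w₀ : HexVertex := (g j i').1
  have hv₀ : v₀ ∈ U j := (hU j v₀).2 ⟨i, mem_hexBall_self _ _⟩
  have hw₀ : w₀ ∈ U j := (hU j w₀).2 ⟨i', mem_hexBall_self _ _⟩
  have hreach := (SimpleGraph.reachable_iff_reflTransGen _ _).1 (hpre j ⟨v₀, hv₀⟩ ⟨w₀, hw₀⟩)
  have hlift : ReflTransGen (fun a b => (a, b) ∈ cellAdj) (k ⟨v₀, hv₀⟩) (k ⟨w₀, hw₀⟩) :=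
    ReflTransGen.lift (r := (hexGraph.induce (U j)).Adj) (p := fun a b => (a, b) ∈ cellAdj) k
      (fun u u' h => hstep u u' h) _ _ hreach
  exact ((ReflTransGen.single (hsame v₀ i _ (mem_hexBall_self _ _) (hk ⟨v₀, hv₀⟩))).trans hlift).trans
    (ReflTransGen.single (hsame w₀ _ i' (hk ⟨w₀, hw₀⟩) (mem_hexBall_self _ _)))

/-- **Cells adjacent at infinitely many levels have intersecting limit hexagons.** -/
theorem limitHex_inter_nonempty_of_frequently (hs : ∀ j, 0 < s j) (hs0 : Tendsto s atTop (𝓝 0))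
    (hC : ∀ i, Tendsto (fun j => (s j : ℂ) * hexCenter (g j i).1 - (s j : ℂ) * triEmbed (x j)) atTop (𝓝 (C i)))
    (hϱ : ∀ i, Tendsto (fun j => s j * ((g j i).2 + 1 / 2)) atTop (𝓝 (ϱ i))) {i i' : Fin N}
    (hfreq : ∃ᶠ j in atTop, ∃ v ∈ hexBall (g j i).1 (g j i).2, ∃ w ∈ hexBall (g j i').1 (g j i').2,
      dist ((s j : ℂ) * hexCenter v) ((s j : ℂ) * hexCenter w) ≤ s j) :
    ({z : ℂ | ∀ ℓ : Fin 3, |skewCoord ℓ (z - C i)| ≤ ϱ i} ∩ {z : ℂ | ∀ ℓ : Fin 3, |skewCoord ℓ (z - C i')| ≤ ϱ i'}).Nonempty := by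
  by_contra hempty
  rw [not_nonempty_iff_eq_empty, ← disjoint_iff_inter_eq_empty] at hempty
  -- separate the two compact hexagons by skew thickenings
  have hsep : ∃ ε > (0 : ℝ), Disjoint {z : ℂ | ∀ ℓ : Fin 3, |skewCoord ℓ (z - C i)| ≤ ϱ i + ε}
      {z : ℂ | ∀ ℓ : Fin 3, |skewCoord ℓ (z - C i')| ≤ ϱ i' + ε} := by
    have hK : IsCompact {z : ℂ | ∀ ℓ : Fin 3, |skewCoord ℓ (z - C i)| ≤ ϱ i} := by
      rw [skewHexAbs_eq]; exact isCompact_skewHex _ _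
    rw [skewHexAbs_eq (C i') (ϱ i')] at hempty
    obtain ⟨ε₁, hε₁, h1⟩ := exists_pos_disjoint_skewHex_thicken hK hempty
    have hK' : IsCompact {z : ℂ | ∀ ℓ : Fin 3, (skewCoord ℓ (C i') - ϱ i') - ε₁ ≤ skewCoord ℓ z ∧
        skewCoord ℓ z ≤ (skewCoord ℓ (C i') + ϱ i') + ε₁} := isCompact_skewHex _ _
    rw [skewHexAbs_eq (C i) (ϱ i)] at h1
    obtain ⟨ε₂, hε₂, h2⟩ := exists_pos_disjoint_skewHex_thicken hK' h1.symm
    refine ⟨min ε₁ ε₂, lt_min hε₁ hε₂, Set.disjoint_left.2 fun z hz hz' => ?_⟩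
    have hzA : z ∈ {z : ℂ | ∀ ℓ : Fin 3, (skewCoord ℓ (C i') - ϱ i') - ε₁ ≤ skewCoord ℓ z ∧
        skewCoord ℓ z ≤ (skewCoord ℓ (C i') + ϱ i') + ε₁} := fun ℓ => by
      have := hz' ℓ; rw [skewCoord_sub, abs_le] at this
      constructor <;> linarith [min_le_left ε₁ ε₂]
    have hzB : z ∈ {z : ℂ | ∀ ℓ : Fin 3, (skewCoord ℓ (C i) - ϱ i) - ε₂ ≤ skewCoord ℓ z ∧
        skewCoord ℓ z ≤ (skewCoord ℓ (C i) + ϱ i) + ε₂} := fun ℓ => by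
      have := hz ℓ; rw [skewCoord_sub, abs_le] at this
      constructor <;> linarith [min_le_right ε₁ ε₂]
    exact Set.disjoint_left.1 h2 hzA hzB
  obtain ⟨ε, hε, hdisj⟩ := hsep
  have h3 : ∀ᶠ j in atTop, 2 * s j < ε / 2 := by
    have : Tendsto (fun j => 2 * s j) atTop (𝓝 (2 * 0)) := hs0.const_mul 2
    rw [mul_zero] at this; exact this.eventually (gt_mem_nhds (by positivity))
  obtain ⟨j, ⟨v, hv, w, hw, hvw⟩, hj, hj3⟩ :=
    (hfreq.and_eventually ((eventually_cells_subset_thicken hs hs0 hC hϱ (half_pos hε)).and h3)).exists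
  set τ : ℂ := (s j : ℂ) * triEmbed (x j)
  have hzA : (s j : ℂ) * hexCenter v - τ ∈ {z : ℂ | ∀ ℓ : Fin 3, |skewCoord ℓ (z - C i)| ≤ ϱ i + ε} := fun ℓ => by
    have := hj i v hv ℓ; linarith
  have hzB : (s j : ℂ) * hexCenter v - τ ∈ {z : ℂ | ∀ ℓ : Fin 3, |skewCoord ℓ (z - C i')| ≤ ϱ i' + ε} := fun ℓ => by
    have h4 := hj i' w hw ℓ
    have h5 := abs_skewCoord_sub_le_add ℓ ((s j : ℂ) * hexCenter v - τ) ((s j : ℂ) * hexCenter w - τ) (C i')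
    rw [dist_sub_right, dist_comm] at h5
    linarith
  exact Set.disjoint_left.1 hdisj hzA hzB

/-- **THE UNION OF THE CLOSED LIMIT HEXAGONS OF A PRECONNECTED LEVEL IS CONNECTED.** -/
theorem isConnected_iUnion_limitHex [Nonempty (Fin N)] (hs : ∀ j, 0 < s j) (hs0 : Tendsto s atTop (𝓝 0))
    {U : ℕ → Set HexVertex} (hU : ∀ j (v : HexVertex), v ∈ U j ↔ ∃ i, v ∈ hexBall (g j i).1 (g j i).2)
    (hpre : ∀ j, (hexGraph.induce (U j)).Preconnected)
    (hC : ∀ i, Tendsto (fun j => (s j : ℂ) * hexCenter (g j i).1 - (s j : ℂ) * triEmbed (x j)) atTop (𝓝 (C i)))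
    (hϱ : ∀ i, Tendsto (fun j => s j * ((g j i).2 + 1 / 2)) atTop (𝓝 (ϱ i))) (hϱ0 : ∀ i, 0 ≤ ϱ i) :
    IsConnected (⋃ i, {z : ℂ | ∀ ℓ : Fin 3, |skewCoord ℓ (z - C i)| ≤ ϱ i}) := by
  -- adjacency at infinitely many levels
  set cellAdj : ℕ → Set (Fin N × Fin N) := fun j => {p | ∃ v ∈ hexBall (g j p.1).1 (g j p.1).2,
    ∃ w ∈ hexBall (g j p.2).1 (g j p.2).2, dist ((s j : ℂ) * hexCenter v) ((s j : ℂ) * hexCenter w) ≤ s j} with hcA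
  set A : Fin N → Fin N → Prop := fun i i' => ∃ᶠ j in atTop, (i, i') ∈ cellAdj j with hA
  -- from some level on, every adjacency is an `A`-adjacency
  have hev : ∀ᶠ j in atTop, ∀ p : Fin N × Fin N, p ∈ cellAdj j → A p.1 p.2 := by
    rw [eventually_all]
    intro p
    by_cases hp : A p.1 p.2
    · exact Eventually.of_forall fun j _ => hp
    · have : ∀ᶠ j in atTop, ¬ (p.1, p.2) ∈ cellAdj j := by
        rw [hA] at hp; simpa [Filter.not_frequently] using hp
      exact this.mono fun j hj h => absurd h hj
  obtain ⟨j₀, hj₀⟩ := hev.exists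
  have hRT : ∀ i i', ReflTransGen A i i' := fun i i' =>
    ReflTransGen.mono (fun a b h => hj₀ (a, b) h) _ _ (reflTransGen_cellAdj hs hU hpre j₀ i i')
  refine IsConnected.iUnion_of_reflTransGen (fun i => isConnected_skewHexAbs (C i) (hϱ0 i)) fun i i' => ?_
  exact ReflTransGen.mono (fun a b h => limitHex_inter_nonempty_of_frequently hs hs0 hC hϱ h) _ _ (hRT i i')

end Cells

/-! ### Plane topology: components of an open set with connected complement -/

/-- **A component of an open set `O ⊆ ℂ` whose complement `Oᶜ` is connected has connected
complement**: every other component is open with nonempty frontier inside `Oᶜ`. -/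
theorem isConnected_compl_connectedComponentIn {O : Set ℂ} (hO : IsOpen O) (hOc : IsConnected Oᶜ) (b : ℂ) :
    IsConnected (connectedComponentIn O b)ᶜ := by
  by_cases hb : b ∈ O
  swap
  · rw [connectedComponentIn_eq_empty hb, compl_empty]; exact isConnected_univ
  obtain ⟨x₀, hx₀⟩ := hOc.nonempty
  -- every component of `O`, together with `Oᶜ`, is connected
  have hcomp : ∀ p ∈ O, IsConnected (connectedComponentIn O p ∪ Oᶜ) := by
    intro p hp
    set Cp := connectedComponentIn O p with hCp
    have hCo : IsOpen Cp := hO.connectedComponentIn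
    have hCne : Cp.Nonempty := ⟨p, mem_connectedComponentIn hp⟩
    have hCuniv : Cp ≠ univ := fun h =>
      hx₀ (connectedComponentIn_subset O p (show x₀ ∈ Cp by rw [h]; exact mem_univ _))
    obtain ⟨z, hz⟩ := nonempty_frontier_iff.2 ⟨hCne, hCuniv⟩
    have hzC : z ∉ Cp := fun h => by
      have hmem : z ∈ Cp ∩ frontier Cp := ⟨h, hz⟩
      rw [hCo.inter_frontier_eq] at hmem
      exact hmem
    have hzO : z ∈ Oᶜ := by
      intro hzO
      have hzcl : z ∈ closure Cp := frontier_subset_closure hz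
      have hnhds : connectedComponentIn O z ∈ 𝓝 z :=
        hO.connectedComponentIn.mem_nhds (mem_connectedComponentIn hzO)
      obtain ⟨y, hyz, hyC⟩ := mem_closure_iff_nhds.1 hzcl _ hnhds
      refine hzC ?_
      rw [hCp, connectedComponentIn_eq hyC, ← connectedComponentIn_eq hyz]
      exact mem_connectedComponentIn hzO
    have h1 : IsPreconnected (Cp ∪ {z}) :=
      isPreconnected_connectedComponentIn.subset_closure subset_union_left
        (union_subset subset_closure (singleton_subset_iff.2 (frontier_subset_closure hz)))
    have h2 : IsPreconnected (Cp ∪ {z} ∪ Oᶜ) :=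
      h1.union z (mem_union_right _ rfl) hzO hOc.isPreconnected
    refine ⟨⟨p, mem_union_left _ (mem_connectedComponentIn hp)⟩, ?_⟩
    have e : Cp ∪ Oᶜ = Cp ∪ {z} ∪ Oᶜ := by
      rw [union_assoc, singleton_union, insert_eq_of_mem hzO]
    rw [e]; exact h2
  -- the complement of the component of `b` is the union of these over the other points of `O`
  set Ω := connectedComponentIn O b with hΩ
  set T : ℂ → Set ℂ := fun p => {z : ℂ | z ∈ connectedComponentIn O p ∧ p ∈ O \ Ω} ∪ Oᶜ with hT
  have hTpre : ∀ p, IsPreconnected (T p) := by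
    intro p
    by_cases hp : p ∈ O \ Ω
    · have e : T p = connectedComponentIn O p ∪ Oᶜ := by
        ext z; simp only [hT, mem_union, mem_setOf_eq, hp, and_true]
      rw [e]; exact (hcomp p hp.1).isPreconnected
    · have e : T p = Oᶜ := by
        ext z; simp only [hT, mem_union, mem_setOf_eq, hp, and_false, false_or]
      rw [e]; exact hOc.isPreconnected
  have hTx₀ : ∀ p, x₀ ∈ T p := fun p => mem_union_right _ hx₀
  have hdec : Ωᶜ = ⋃ p, T p := by
    ext z
    simp only [mem_compl_iff, mem_iUnion]
    constructor
    · intro hz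
      by_cases hzO : z ∈ O
      · exact ⟨z, mem_union_left _ ⟨mem_connectedComponentIn hzO, hzO, hz⟩⟩
      · exact ⟨z, mem_union_right _ hzO⟩
    · rintro ⟨p, ⟨hzp, hpO, hpΩ⟩ | hzO⟩ hzΩ
      · refine hpΩ ?_
        rw [hΩ, connectedComponentIn_eq hzΩ, ← connectedComponentIn_eq hzp]
        exact mem_connectedComponentIn hpO
      · exact hzO (connectedComponentIn_subset O b hzΩ)
  rw [hdec]
  exact ⟨⟨x₀, mem_iUnion.2 ⟨b, hTx₀ b⟩⟩, isPreconnected_iUnion ⟨x₀, mem_iInter.2 hTx₀⟩ hTpre⟩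

/-- **Registered carrier `stub_carvedReduction_limitUnion`** (crux item stmt-CriticalPhenomena-10472,
stub T-A′₂ `stub_carvedReduction_squeezeGeometry_domainsCore`, piece THE UNION OF THE LIMIT HEXAGONS IS
CONNECTED / components with connected complement): registry form of
`isConnected_compl_connectedComponentIn`. -/
theorem stub_carvedReduction_limitUnion :
    ∀ (O : Set ℂ) (b : ℂ), IsOpen O → IsConnected Oᶜ → IsConnected (connectedComponentIn O b)ᶜ :=
  fun _ b hO hOc => isConnected_compl_connectedComponentIn hO hOc b

end Summit.CriticalPhenomena.SAWScalingLimit.Theorems.ObservableToSLE.TypeLadder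

end
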